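import Summits.Ventures.Crystal3D.Theorems.StickyWulffConstantCoaxialWallLawJammedMono
import HarnessLib

/-!
# OFF-MODULE NON-CAPPING BALLS NEVER BREAK MONO-MODULARITY: a structure theorem for the T5b residual
# (crux `CoaxialWallLaw`, stmt-Ventures-19481; line `WallLedgerF`, skeleton 'CoaxialWallLawCertificates' v5, stub `stub_seamResidual`)

HONEST FRAMING. Venture `Summits/Ventures/Crystal3D` (cell `crystal3d-full`), helper `--supports` the crux `CoaxialWallLaw` of
`route-Ventures-StickyWulffConstant` (REGISTERED line `WallLedgerF`, skeleton 'Certificates' v5).  Rung credit only; F-C1 not moved; census-free, kissing-free.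
GENERALISES `…JammedMono` (one jammed ball) to ARBITRARY off-module content: call a ball CAPPING (within `3` of the payer) if it touches three pairwise touching balls of
the window.  **If some placement `S` puts the payer window in a position where every ball within `3` of the payer is EITHER a point of the coaxial module OR
non-capping, then the window is mono-module (`MonoModuleAt L X z`, every frame `L`).**  Contrapositively, every window of the seam residue
(`¬ MonoModuleAt`) carries, for EVERY placement, an off-module CAPPING ball within `3` of the payer — a crystalline fragment of a second grain, an apex capper,
or a tetrahedral junk cluster; loose dust of any amount and any degree is never the reason.  No separation, degree or universe hypothesis is used.
* set versions of the frame lemmas of `…JammedFrames` (hypothesis: off-module balls within `3` are non-capping): `mem_module_of_reader_nc` (a reader is a module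
  ball — else it would cap its own reading triangle), `menu_of_triangle_nc`, `image_eq_of_reader_nc`, `slots_mem_module_of_reader_nc`,
  `mirror_mem_module_of_twinReading_nc`;
* **`monoModuleAt_of_nonCapping`** — the structure theorem (model-position hypothesis on `X.image (x ↦ S⁻¹x − S⁻¹z)`);
* `exists_capping_of_not_monoModuleAt` — the contrapositive, as the residual's usable shape.
WHAT THIS IS NOT: not a bound on the seam residue; F-C1 not moved.
-/

noncomputable section

namespace Summit.Ventures.Crystal3D.Theorems

namespace TailResidue

open Summit.Ventures.Crystal3D Finset
open Literature.MathematicalPhysics.StatisticalMechanics (basalMirror)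
open scoped InnerProductSpace

section NonCapping

variable {Y : Finset (EuclideanSpace ℝ (Fin 3))} {v : WordVersion}
  (hnc : ∀ y ∈ Y, dist (0 : EuclideanSpace ℝ (Fin 3)) y ≤ 3 → y ∉ coaxialModule 1 (Real.sqrt (2 / 3)) →
    ∀ t₁ ∈ Y, ∀ t₂ ∈ Y, ∀ t₃ ∈ Y, dist t₁ t₂ = 1 → dist t₁ t₃ = 1 → dist t₂ t₃ = 1 →
      dist y t₁ = 1 → dist y t₂ = 1 → dist y t₃ = 1 → False)

include hnc in
/-- A ball within `3` of the payer touching three pairwise touching balls is a module point. -/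
theorem mem_module_of_caps {y t₁ t₂ t₃ : EuclideanSpace ℝ (Fin 3)} (hy : y ∈ Y) (hy3 : dist (0 : EuclideanSpace ℝ (Fin 3)) y ≤ 3)
    (h₁ : t₁ ∈ Y) (h₂ : t₂ ∈ Y) (h₃ : t₃ ∈ Y) (d12 : dist t₁ t₂ = 1) (d13 : dist t₁ t₃ = 1) (d23 : dist t₂ t₃ = 1)
    (e1 : dist y t₁ = 1) (e2 : dist y t₂ = 1) (e3 : dist y t₃ = 1) : y ∈ coaxialModule 1 (Real.sqrt (2 / 3)) := by
  by_contra hoff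
  exact hnc y hy hy3 hoff t₁ h₁ t₂ h₂ t₃ h₃ d12 d13 d23 e1 e2 e3

include hnc in
/-- **A reader within `2` of the payer is a module ball** (else it would cap its own reading triangle). -/
theorem mem_module_of_reader_nc {q : EuclideanSpace ℝ (Fin 3)} (hq : q ∈ Y) (hq2 : dist (0 : EuclideanSpace ℝ (Fin 3)) q ≤ 2)
    {G : EuclideanSpace ℝ (Fin 3) ≃ₗᵢ[ℝ] EuclideanSpace ℝ (Fin 3)} {d b : EuclideanSpace ℝ (Fin 3)} (hmove : IsEndMove Y v G d q b) :
    q ∈ coaxialModule 1 (Real.sqrt (2 / 3)) := by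
  obtain ⟨u₁, hu₁, u₂, hu₂, u₃, hu₃, h12, h13, h23, o1, o2, o3⟩ := exists_contact_triangle_of_isEndMove hmove
  exact mem_module_of_caps hnc hq (by linarith) o1 o2 o3 (dist_frame_slots_eq_one G q hu₁ hu₂ h12) (dist_frame_slots_eq_one G q hu₁ hu₃ h13)
    (dist_frame_slots_eq_one G q hu₂ hu₃ h23) (dist_slotSite_eq_one G q hu₁) (dist_slotSite_eq_one G q hu₂) (dist_slotSite_eq_one G q hu₃)

include hnc in
/-- The three balls of an occupied slot triangle of a module ball `q` within `2` of the payer are module points; their slot images are menu vectors. -/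
theorem menu_of_triangle_nc {q : EuclideanSpace ℝ (Fin 3)} (hqM : q ∈ coaxialModule 1 (Real.sqrt (2 / 3))) (hq : q ∈ Y)
    (hq2 : dist (0 : EuclideanSpace ℝ (Fin 3)) q ≤ 2) (G : EuclideanSpace ℝ (Fin 3) ≃ₗᵢ[ℝ] EuclideanSpace ℝ (Fin 3))
    {u₁ u₂ u₃ : EuclideanSpace ℝ (Fin 3)} (hu₁ : u₁ ∈ fccSlots) (hu₂ : u₂ ∈ fccSlots) (hu₃ : u₃ ∈ fccSlots)
    (h12 : ⟪u₁, u₂⟫_ℝ = 1 / 2) (h13 : ⟪u₁, u₃⟫_ℝ = 1 / 2) (h23 : ⟪u₂, u₃⟫_ℝ = 1 / 2)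
    (o1 : q + G u₁ ∈ Y) (o2 : q + G u₂ ∈ Y) (o3 : q + G u₃ ∈ Y) :
    (G u₁ ∈ fccSlots ∨ G u₁ ∈ (basalMirror : EuclideanSpace ℝ (Fin 3) → EuclideanSpace ℝ (Fin 3)) '' ↑fccSlots) ∧
    (G u₂ ∈ fccSlots ∨ G u₂ ∈ (basalMirror : EuclideanSpace ℝ (Fin 3) → EuclideanSpace ℝ (Fin 3)) '' ↑fccSlots) ∧
    (G u₃ ∈ fccSlots ∨ G u₃ ∈ (basalMirror : EuclideanSpace ℝ (Fin 3) → EuclideanSpace ℝ (Fin 3)) '' ↑fccSlots) := by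
  have h21 : ⟪u₂, u₁⟫_ℝ = 1 / 2 := by rw [real_inner_comm]; exact h12
  have h31 : ⟪u₃, u₁⟫_ℝ = 1 / 2 := by rw [real_inner_comm]; exact h13
  have h32 : ⟪u₃, u₂⟫_ℝ = 1 / 2 := by rw [real_inner_comm]; exact h23
  have far : ∀ {u : EuclideanSpace ℝ (Fin 3)}, u ∈ fccSlots → dist (0 : EuclideanSpace ℝ (Fin 3)) (q + G u) ≤ 3 := by
    intro u hu
    linarith [dist_triangle (0 : EuclideanSpace ℝ (Fin 3)) q (q + G u), dist_slotSite_eq_one G q hu]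
  -- each triangle ball caps `{q, the other two}`, so it is a module point
  have key : ∀ {a b c : EuclideanSpace ℝ (Fin 3)}, a ∈ fccSlots → b ∈ fccSlots → c ∈ fccSlots →
      ⟪a, b⟫_ℝ = 1 / 2 → ⟪a, c⟫_ℝ = 1 / 2 → ⟪b, c⟫_ℝ = 1 / 2 → q + G a ∈ Y → q + G b ∈ Y → q + G c ∈ Y →
      q + G a ∈ coaxialModule 1 (Real.sqrt (2 / 3)) := by
    intro a b c ha hb hc hab hac hbc hoa hob hoc
    refine mem_module_of_caps hnc hoa (far ha) hq hob hoc (dist_slotSite_eq_one G q hb) (dist_slotSite_eq_one G q hc)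
      (dist_frame_slots_eq_one G q hb hc hbc) ?_ ?_ ?_
    · rw [dist_comm]; exact dist_slotSite_eq_one G q ha
    · exact dist_frame_slots_eq_one G q ha hb hab
    · exact dist_frame_slots_eq_one G q ha hc hac
  have m1 := key hu₁ hu₂ hu₃ h12 h13 h23 o1 o2 o3
  have m2 := key hu₂ hu₁ hu₃ h21 h23 h13 o2 o1 o3
  have m3 := key hu₃ hu₁ hu₂ h31 h32 h12 o3 o1 o2
  have menu : ∀ {u : EuclideanSpace ℝ (Fin 3)}, u ∈ fccSlots → q + G u ∈ coaxialModule 1 (Real.sqrt (2 / 3)) →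
      G u ∈ fccSlots ∨ G u ∈ (basalMirror : EuclideanSpace ℝ (Fin 3) → EuclideanSpace ℝ (Fin 3)) '' ↑fccSlots := by
    intro u hu hM
    have := coaxialModule_neighbour_mem hqM hM (dist_slotSite_eq_one G q hu)
    rwa [add_sub_cancel_left] at this
  exact ⟨menu hu₁ m1, menu hu₂ m2, menu hu₃ m3⟩

include hnc in
/-- **The class frame of every reader within `2` of the payer is `D₊` or `D₋`.** -/
theorem image_eq_of_reader_nc {q : EuclideanSpace ℝ (Fin 3)} (hq : q ∈ Y) (hq2 : dist (0 : EuclideanSpace ℝ (Fin 3)) q ≤ 2)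
    {G : EuclideanSpace ℝ (Fin 3) ≃ₗᵢ[ℝ] EuclideanSpace ℝ (Fin 3)} {d b : EuclideanSpace ℝ (Fin 3)} (hmove : IsEndMove Y v G d q b) :
    (G : EuclideanSpace ℝ (Fin 3) → EuclideanSpace ℝ (Fin 3)) '' ↑fccSlots = ↑fccSlots ∨
      (G : EuclideanSpace ℝ (Fin 3) → EuclideanSpace ℝ (Fin 3)) '' ↑fccSlots =
        (basalMirror : EuclideanSpace ℝ (Fin 3) → EuclideanSpace ℝ (Fin 3)) '' ↑fccSlots := by
  have hqM := mem_module_of_reader_nc hnc hq hq2 hmove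
  obtain ⟨u₁, hu₁, u₂, hu₂, u₃, hu₃, h12, h13, h23, o1, o2, o3⟩ := exists_contact_triangle_of_isEndMove hmove
  obtain ⟨m1, m2, m3⟩ := menu_of_triangle_nc hnc hqM hq hq2 G hu₁ hu₂ hu₃ h12 h13 h23 o1 o2 o3
  have hG12 : ⟪G u₁, G u₂⟫_ℝ = 1 / 2 := by rw [LinearIsometryEquiv.inner_map_map, h12]
  have hG13 : ⟪G u₁, G u₃⟫_ℝ = 1 / 2 := by rw [LinearIsometryEquiv.inner_map_map, h13]
  have hG23 : ⟪G u₂, G u₃⟫_ℝ = 1 / 2 := by rw [LinearIsometryEquiv.inner_map_map, h23]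
  rcases face_pure_of_neighbourMenu m1 m2 m3 hG12 hG13 hG23 with ⟨f1, f2, f3⟩ | ⟨f1, f2, f3⟩
  · left
    have hrefl : ((LinearIsometryEquiv.refl ℝ (EuclideanSpace ℝ (Fin 3)) :
        EuclideanSpace ℝ (Fin 3) → EuclideanSpace ℝ (Fin 3)) '' ↑fccSlots) = ↑fccSlots := by
      simp
    have key := image_fccSlots_eq_of_triangle G (LinearIsometryEquiv.refl ℝ _) hu₁ hu₂ hu₃ h12 h13 h23
      (by rw [hrefl]; exact mem_coe.2 f1) (by rw [hrefl]; exact mem_coe.2 f2) (by rw [hrefl]; exact mem_coe.2 f3)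
    rwa [hrefl] at key
  · right
    exact image_fccSlots_eq_of_triangle G basalMirror hu₁ hu₂ hu₃ h12 h13 h23 f1 f2 f3

include hnc in
/-- **Every slot image of a reader's class frame is a module vector.** -/
theorem slots_mem_module_of_reader_nc {q : EuclideanSpace ℝ (Fin 3)} (hq : q ∈ Y) (hq2 : dist (0 : EuclideanSpace ℝ (Fin 3)) q ≤ 2)
    {G : EuclideanSpace ℝ (Fin 3) ≃ₗᵢ[ℝ] EuclideanSpace ℝ (Fin 3)} {d b : EuclideanSpace ℝ (Fin 3)} (hmove : IsEndMove Y v G d q b) :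
    ∀ w ∈ fccSlots, G w ∈ coaxialModule 1 (Real.sqrt (2 / 3)) :=
  slots_mem_module_of_image (image_eq_of_reader_nc hnc hq hq2 hmove)

include hnc in
/-- **The mirrored slots of a firing twin reading within `2` of the payer are module vectors** (its mirror balls cap, so they are module points). -/
theorem mirror_mem_module_of_twinReading_nc {q : EuclideanSpace ℝ (Fin 3)} (hqM : q ∈ coaxialModule 1 (Real.sqrt (2 / 3))) (hq : q ∈ Y)
    (hq2 : dist (0 : EuclideanSpace ℝ (Fin 3)) q ≤ 2) {G : EuclideanSpace ℝ (Fin 3) ≃ₗᵢ[ℝ] EuclideanSpace ℝ (Fin 3)}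
    {m : EuclideanSpace ℝ (Fin 3)} (htw : IsTwinReading Y G m q) (hG : ∀ w ∈ fccSlots, G w ∈ coaxialModule 1 (Real.sqrt (2 / 3))) :
    ∀ w ∈ fccSlots, G w - (2 * ⟪G w, m⟫_ℝ) • m ∈ coaxialModule 1 (Real.sqrt (2 / 3)) := by
  obtain ⟨⟨hm1, hmn⟩, -, hmir, -⟩ := htw
  set M : EuclideanSpace ℝ (Fin 3) ≃ₗᵢ[ℝ] EuclideanSpace ℝ (Fin 3) := (ℝ ∙ m)ᗮ.reflection with hM
  have hMapp : ∀ y, M y = y - (2 * ⟪y, m⟫_ℝ) • m := fun y => by rw [hM, reflection_unit_apply hm1]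
  have hm1' : ‖-m‖ = 1 := by rw [norm_neg, hm1]
  have hmn' : ∀ w ∈ fccSlots, ⟪G w, -m⟫_ℝ = 0 ∨ ⟪G w, -m⟫_ℝ = Real.sqrt (2 / 3) ∨ ⟪G w, -m⟫_ℝ = -Real.sqrt (2 / 3) := by
    intro w hw
    rcases hmn w hw with h0 | h0 | h0
    · exact Or.inl (by rw [inner_neg_right, h0, neg_zero])
    · exact Or.inr (Or.inr (by rw [inner_neg_right, h0]))
    · exact Or.inr (Or.inl (by rw [inner_neg_right, h0, neg_neg]))
  have hrt : 0 < Real.sqrt (2 / 3) := Real.sqrt_pos.2 (by norm_num)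
  obtain ⟨u₁, hu₁, u₂, hu₂, u₃, hu₃, n1, n2, n3, h12, h13, h23, -, honly⟩ := exists_far_frame G hm1' hmn'
  have neg_of : ∀ {w : EuclideanSpace ℝ (Fin 3)}, ⟪G w, -m⟫_ℝ = Real.sqrt (2 / 3) → ⟪G w, m⟫_ℝ < 0 := by
    intro w hw; rw [inner_neg_right] at hw; linarith
  have p1 := hmir u₁ hu₁ (neg_of n1)
  have p2 := hmir u₂ hu₂ (neg_of n2)
  have p3 := hmir u₃ hu₃ (neg_of n3)
  have dq : ∀ {u : EuclideanSpace ℝ (Fin 3)}, u ∈ fccSlots → dist q (q + (G u - (2 * ⟪G u, m⟫_ℝ) • m)) = 1 := by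
    intro u hu
    rw [dist_add_right_eq]
    exact norm_reflectStep_slot G hm1 hu
  have dd : ∀ {u u' : EuclideanSpace ℝ (Fin 3)}, u ∈ fccSlots → u' ∈ fccSlots → ⟪u, u'⟫_ℝ = 1 / 2 →
      dist (q + (G u - (2 * ⟪G u, m⟫_ℝ) • m)) (q + (G u' - (2 * ⟪G u', m⟫_ℝ) • m)) = 1 := by
    intro u u' hu hu' h
    rw [← hMapp, ← hMapp, dist_eq_norm, add_sub_add_left_eq_sub, ← map_sub, ← map_sub, LinearIsometryEquiv.norm_map,
      LinearIsometryEquiv.norm_map]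
    exact norm_eq_one_of_mem_fccSlots (sub_mem_fccSlots_of_inner_eq_half hu hu' h)
  have h21 : ⟪u₂, u₁⟫_ℝ = 1 / 2 := by rw [real_inner_comm]; exact h12
  have h31 : ⟪u₃, u₁⟫_ℝ = 1 / 2 := by rw [real_inner_comm]; exact h13
  have h32 : ⟪u₃, u₂⟫_ℝ = 1 / 2 := by rw [real_inner_comm]; exact h23
  have far : ∀ {u : EuclideanSpace ℝ (Fin 3)}, u ∈ fccSlots → dist (0 : EuclideanSpace ℝ (Fin 3)) (q + (G u - (2 * ⟪G u, m⟫_ℝ) • m)) ≤ 3 := by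
    intro u hu
    linarith [dist_triangle (0 : EuclideanSpace ℝ (Fin 3)) q (q + (G u - (2 * ⟪G u, m⟫_ℝ) • m)), dq hu]
  -- each mirror ball caps `{q, the other two mirror balls}`
  have key : ∀ {a b c : EuclideanSpace ℝ (Fin 3)}, a ∈ fccSlots → b ∈ fccSlots → c ∈ fccSlots →
      ⟪a, b⟫_ℝ = 1 / 2 → ⟪a, c⟫_ℝ = 1 / 2 → ⟪b, c⟫_ℝ = 1 / 2 →
      q + (G a - (2 * ⟪G a, m⟫_ℝ) • m) ∈ Y → q + (G b - (2 * ⟪G b, m⟫_ℝ) • m) ∈ Y → q + (G c - (2 * ⟪G c, m⟫_ℝ) • m) ∈ Y →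
      G a - (2 * ⟪G a, m⟫_ℝ) • m ∈ coaxialModule 1 (Real.sqrt (2 / 3)) := by
    intro a b c ha hb hc hab hac hbc hoa hob hoc
    have hM' := mem_module_of_caps hnc hoa (far ha) hq hob hoc (dq hb) (dq hc) (dd hb hc hbc)
      (by rw [dist_comm]; exact dq ha) (dd ha hb hab) (dd ha hc hac)
    have := sub_mem_module hM' hqM
    rwa [add_sub_cancel_left] at this
  have l1 := key hu₁ hu₂ hu₃ h12 h13 h23 p1 p2 p3
  have l2 := key hu₂ hu₁ hu₃ h21 h23 h13 p2 p1 p3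
  have l3 := key hu₃ hu₁ hu₂ h31 h32 h12 p3 p1 p2
  intro w hw
  rcases hmn w hw with h0 | hpos | hneg
  · rw [h0, mul_zero, zero_smul, sub_zero]; exact hG w hw
  · have hnw : -w ∈ fccSlots := neg_mem_fccSlots hw
    have hn' : ⟪G (-w), -m⟫_ℝ = Real.sqrt (2 / 3) := by rw [map_neg, inner_neg_left, inner_neg_right, neg_neg, hpos]
    have e : G w - (2 * ⟪G w, m⟫_ℝ) • m = -(G (-w) - (2 * ⟪G (-w), m⟫_ℝ) • m) := by
      rw [map_neg, inner_neg_left, mul_neg, neg_smul, sub_neg_eq_add, neg_add, neg_neg, sub_eq_add_neg]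
    rw [e]
    refine neg_mem_module ?_
    rcases honly (-w) hnw (by rw [hn']; exact hrt) with h | h | h
    · rw [h]; exact l1
    · rw [h]; exact l2
    · rw [h]; exact l3
  · have hn' : ⟪G w, -m⟫_ℝ = Real.sqrt (2 / 3) := by rw [inner_neg_right, hneg, neg_neg]
    rcases honly w hw (by rw [hn']; exact hrt) with h | h | h
    · rw [h]; exact l1
    · rw [h]; exact l2
    · rw [h]; exact l3

end NonCapping

/-! ### The structure theorem -/

/-- Module points within `3` of the payer are exact positions. -/
theorem mem_exactPos_of_module {y : EuclideanSpace ℝ (Fin 3)} (hy : y ∈ coaxialModule 1 (Real.sqrt (2 / 3))) (hy3 : dist (0 : EuclideanSpace ℝ (Fin 3)) y ≤ 3) :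
    y ∈ exactPos := by
  obtain ⟨s, rfl⟩ := mem_coaxialModule_iff.1 hy
  refine Or.inl ⟨s, mem_coe.2 (mem_siteBall_of_dsq12 (dsq12_le_of_norm_le_three ?_)), rfl⟩
  rwa [dist_comm, dist_eq_norm, sub_zero] at hy3

open scoped Classical in
/-- **OFF-MODULE NON-CAPPING BALLS NEVER BREAK MONO-MODULARITY.**  If, after the placement `x ↦ S⁻¹x − S⁻¹z`, every ball within `3` of the payer is a point
of the coaxial module or touches no three pairwise touching balls within `3` of the payer, then `MonoModuleAt L X z` (every frame `L`). -/
theorem monoModuleAt_of_nonCapping {L : EuclideanSpace ℝ (Fin 3) ≃ₗᵢ[ℝ] EuclideanSpace ℝ (Fin 3)} {X : Finset (EuclideanSpace ℝ (Fin 3))}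
    {z : EuclideanSpace ℝ (Fin 3)} (S : EuclideanSpace ℝ (Fin 3) ≃ₗᵢ[ℝ] EuclideanSpace ℝ (Fin 3))
    (h : ∀ y ∈ X, dist z y ≤ 3 → S.symm y + -S.symm z ∉ coaxialModule 1 (Real.sqrt (2 / 3)) →
      ∀ t₁ ∈ X, ∀ t₂ ∈ X, ∀ t₃ ∈ X, dist z t₁ ≤ 3 → dist z t₂ ≤ 3 → dist z t₃ ≤ 3 →
        dist t₁ t₂ = 1 → dist t₁ t₃ = 1 → dist t₂ t₃ = 1 → dist y t₁ = 1 → dist y t₂ = 1 → dist y t₃ = 1 → False) :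
    MonoModuleAt L X z := by
  set τ : EuclideanSpace ℝ (Fin 3) → EuclideanSpace ℝ (Fin 3) := fun y => S.symm y + -S.symm z with hτ
  -- the truncated transported window
  set Y : Finset (EuclideanSpace ℝ (Fin 3)) := (X.filter fun y => dist z y ≤ 3).image τ with hY
  have hτd : ∀ a b, dist (τ a) (τ b) = dist a b := fun a b => by rw [hτ]; exact dist_rigid S.symm (-S.symm z) a b
  have hτ0 : ∀ a, dist (0 : EuclideanSpace ℝ (Fin 3)) (τ a) = dist z a := fun a => by rw [hτ]; exact dist_zero_motion S a
  have hYmem : ∀ {y}, y ∈ Y ↔ ∃ y₀ ∈ X, dist z y₀ ≤ 3 ∧ τ y₀ = y := by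
    intro y; rw [hY, mem_image]
    constructor
    · rintro ⟨y₀, hy₀, rfl⟩; exact ⟨y₀, (mem_filter.1 hy₀).1, (mem_filter.1 hy₀).2, rfl⟩
    · rintro ⟨y₀, hy₀, hd, rfl⟩; exact ⟨y₀, mem_filter.2 ⟨hy₀, hd⟩, rfl⟩
  have hwin : ∀ y, dist (0 : EuclideanSpace ℝ (Fin 3)) y ≤ 3 → (y ∈ X.image τ ↔ y ∈ Y) := by
    intro y hy
    constructor
    · intro hyX
      obtain ⟨y₀, hy₀, rfl⟩ := mem_image.1 hyX
      exact hYmem.2 ⟨y₀, hy₀, by rw [← hτ0]; exact hy, rfl⟩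
    · intro hyY
      obtain ⟨y₀, hy₀, -, rfl⟩ := hYmem.1 hyY
      exact mem_image_of_mem _ hy₀
  -- the non-capping hypothesis in model position
  have hnc : ∀ y ∈ Y, dist (0 : EuclideanSpace ℝ (Fin 3)) y ≤ 3 → y ∉ coaxialModule 1 (Real.sqrt (2 / 3)) →
      ∀ t₁ ∈ Y, ∀ t₂ ∈ Y, ∀ t₃ ∈ Y, dist t₁ t₂ = 1 → dist t₁ t₃ = 1 → dist t₂ t₃ = 1 →
        dist y t₁ = 1 → dist y t₂ = 1 → dist y t₃ = 1 → False := by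
    intro y hy _ hoff t₁ ht₁ t₂ ht₂ t₃ ht₃ d12 d13 d23 e1 e2 e3
    obtain ⟨y₀, hy₀, hyd, rfl⟩ := hYmem.1 hy
    obtain ⟨s₁, hs₁, hd₁, rfl⟩ := hYmem.1 ht₁
    obtain ⟨s₂, hs₂, hd₂, rfl⟩ := hYmem.1 ht₂
    obtain ⟨s₃, hs₃, hd₃, rfl⟩ := hYmem.1 ht₃
    rw [hτd] at d12 d13 d23 e1 e2 e3
    exact h y₀ hy₀ hyd hoff s₁ hs₁ s₂ hs₂ s₃ hs₃ hd₁ hd₂ hd₃ d12 d13 d23 e1 e2 e3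
  refine ⟨S, fun b q G d hb hq hbX hadm _ hmove => ?_⟩
  obtain ⟨w₀, hw₀, hdw⟩ : ∃ w₀ ∈ fccSlots, d = G w₀ := by
    rcases hadm with h' | h'
    · exact (exists_slots_of_adm (basalSystem_roots _) h').1
    · exact (exists_slots_of_adm (basalSystem_roots _) h').1
  have hd1 : ‖d‖ = 1 := by rw [hdw, LinearIsometryEquiv.norm_map, norm_eq_one_of_mem_fccSlots hw₀]
  have hbq : dist b q = 1 := dist_eq_one_of_isEndMove hd1 hmove
  have hq2 : dist (0 : EuclideanSpace ℝ (Fin 3)) q ≤ 2 := by linarith [dist_triangle (0 : EuclideanSpace ℝ (Fin 3)) b q]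
  have hmoveY : IsEndMove Y WordVersion.v2 G d q b := (isEndMove_congr_of_agree hwin WordVersion.v2 G hd1 (by linarith) (by linarith)).1 hmove
  have hqY : q ∈ Y := (hwin q (by linarith)).1 hq
  have hbY : b ∈ Y := (hwin b (by linarith)).1 hbX
  have hqM := mem_module_of_reader_nc hnc hqY hq2 hmoveY
  have hG := slots_mem_module_of_reader_nc hnc hqY hq2 hmoveY
  have hbM : b ∈ coaxialModule 1 (Real.sqrt (2 / 3)) := by
    rcases hmoveY with ⟨-, hbe, -⟩ | ⟨m, htw, -, hbe, -⟩
    · rw [hbe, hdw]; exact add_mem_module hqM (hG w₀ hw₀)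
    · rw [hbe, hdw]; exact sub_mem_module hqM (mirror_mem_module_of_twinReading_nc hnc hqM hqY hq2 htw hG w₀ hw₀)
  obtain ⟨sq, rfl⟩ := mem_coaxialModule_iff.1 hqM
  obtain ⟨sb, rfl⟩ := mem_coaxialModule_iff.1 hbM
  have hsq : dsq12 (0, 0, 0) sq ≤ 108 := dsq12_le_of_norm_le_three (by rw [← dist_zero_left]; linarith)
  have hsb : dsq12 (0, 0, 0) sb ≤ 108 := dsq12_le_of_norm_le_three (by rw [← dist_zero_left]; linarith)
  refine ⟨mem_exactPos_of_module hqM (by linarith), mem_exactPos_of_module hbM (by linarith), fun y hy hins => ?_⟩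
  obtain ⟨w, hw, hcase⟩ := hins
  have hy3 : dist (0 : EuclideanSpace ℝ (Fin 3)) y ≤ 3 := by
    have hb2 : dist (0 : EuclideanSpace ℝ (Fin 3)) (modSite sb) ≤ 2 := by linarith
    rcases hcase with rfl | rfl | ⟨m, hm, rfl | rfl⟩
    · linarith [dist_triangle (0 : EuclideanSpace ℝ (Fin 3)) (modSite sq) (modSite sq + G w), dist_slotSite_eq_one G (modSite sq) hw]
    · linarith [dist_triangle (0 : EuclideanSpace ℝ (Fin 3)) (modSite sb) (modSite sb + G w), dist_slotSite_eq_one G (modSite sb) hw]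
    · have : dist (modSite sq) (modSite sq + (G w - (2 * ⟪G w, m⟫_ℝ) • m)) = 1 := by rw [dist_add_right_eq]; exact norm_reflectStep_slot G hm.1 hw
      linarith [dist_triangle (0 : EuclideanSpace ℝ (Fin 3)) (modSite sq) (modSite sq + (G w - (2 * ⟪G w, m⟫_ℝ) • m))]
    · have : dist (modSite sb) (modSite sb + (G w - (2 * ⟪G w, m⟫_ℝ) • m)) = 1 := by rw [dist_add_right_eq]; exact norm_reflectStep_slot G hm.1 hw
      linarith [dist_triangle (0 : EuclideanSpace ℝ (Fin 3)) (modSite sb) (modSite sb + (G w - (2 * ⟪G w, m⟫_ℝ) • m))]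
  by_cases hyM : y ∈ coaxialModule 1 (Real.sqrt (2 / 3))
  · exact mem_exactPos_of_module hyM hy3
  · rcases hcase with hxe | hxe | ⟨m, hm, hxe | hxe⟩
    · exact absurd (by rw [hxe]; exact add_mem_module hqM (hG w hw)) hyM
    · exact absurd (by rw [hxe]; exact add_mem_module hbM (hG w hw)) hyM
    · exact mem_exactPos_of_mirror hG hm hw hsq hxe hyM hy3
    · exact mem_exactPos_of_mirror hG hm hw hsb hxe hyM hy3

open scoped Classical in
/-- **The residual's usable shape**: at a window that is NOT mono-module, every placement sees an OFF-MODULE CAPPING ball within `3` of the payer. -/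
theorem exists_capping_of_not_monoModuleAt {L : EuclideanSpace ℝ (Fin 3) ≃ₗᵢ[ℝ] EuclideanSpace ℝ (Fin 3)} {X : Finset (EuclideanSpace ℝ (Fin 3))}
    {z : EuclideanSpace ℝ (Fin 3)} (hM : ¬ MonoModuleAt L X z) (S : EuclideanSpace ℝ (Fin 3) ≃ₗᵢ[ℝ] EuclideanSpace ℝ (Fin 3)) :
    ∃ y ∈ X, dist z y ≤ 3 ∧ S.symm y + -S.symm z ∉ coaxialModule 1 (Real.sqrt (2 / 3)) ∧
      ∃ t₁ ∈ X, ∃ t₂ ∈ X, ∃ t₃ ∈ X, dist z t₁ ≤ 3 ∧ dist z t₂ ≤ 3 ∧ dist z t₃ ≤ 3 ∧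
        dist t₁ t₂ = 1 ∧ dist t₁ t₃ = 1 ∧ dist t₂ t₃ = 1 ∧ dist y t₁ = 1 ∧ dist y t₂ = 1 ∧ dist y t₃ = 1 := by
  by_contra hne
  push Not at hne
  exact hM (monoModuleAt_of_nonCapping S fun y hy hy3 hoff t₁ h₁ t₂ h₂ t₃ h₃ d₁ d₂ d₃ e12 e13 e23 f1 f2 f3 =>
    absurd f3 (hne y hy hy3 hoff t₁ h₁ t₂ h₂ t₃ h₃ d₁ d₂ d₃ e12 e13 e23 f1 f2))

end TailResidue

end Summit.Ventures.Crystal3D.Theorems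

end
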